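import Summits.QuantumFields.YangMills.Theorems.BalabanUVNodesN19LawPriceModulus

/-!
# YM-DAG node N19 (= NE7 proper) — THE LAW-LEVEL PRICE, IV: laws on `[−1, 1]` (the range of the node's product observable) by affine transport

Cell `pub-ymgap`, HUMAN RULING D-0062 (Track A), R141 (C) wider-strategy seat `pub-ymgap-dag-n19-e` (strategy s3 = ALTERNATIVE CURRENCY), generation
g17, module 6 (sibling of `…N19LawPriceUpper` ∕ `…N19LawPriceModulus`, filed right before).  Route `Summits/QuantumFields/YangMills/Theses/BalabanUVNodes.lean`
rev 25, cluster item K3⁷ «SpineGivenEndpointR13SepCoPH» (stmt-QuantumFields-20544, dag-lead WORDS-143); filed `--supports` that item `--as helper` (it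
proves no registered stub).  COUNT-NEUTRAL: Mathlib measure bookkeeping (`Measure.map`, `integral_map`, `mgf_id_map`) + the two siblings BY NAME; no scheme
object, no Theses import; NOT a discharge claim.

WHY.  The siblings price the LAW for probability laws on `[0, 1]` (where Mathlib's Bernstein polynomials live); the node's observable — the product of a
string of bounded gauge observables — takes values in `[−1, 1]`, and g9's continuum law (p504707 ∕ p505344 `exists_continuumLaw_of_target`) is a law on
`[−1, 1]`.  This module transports: `φ(x) = (x+1)∕2` pushes a law on `[−1,1]` to a law on `[0,1]` with `∫ g d(κ∘φ⁻¹) = ∫ g∘φ dκ` and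
`cgf_{κ∘φ⁻¹}(t) = t∕2 + cgf_κ(t∕2)` (§1) — so cgf DIFFERENCES `ε`-close on `|t| ≤ l₀` stay `ε`-close on `|t| ≤ 2l₀` after transport, and a `K`-Lipschitz test
function pulls back to a `2K`-Lipschitz one.  §2: ★★ `abs_integral_sub_integral_le_lipschitz_of_cgf_close_symm` (laws on `[−1,1]`, cgf's `ε`-close on
`|t| ≤ l₀`, `g` `K`-Lipschitz with `|g| ≤ G` on `[−1,1]`: `|∫ g dν − ∫ g dμ| ≤ 2K∕√n + G·(3A′)ⁿ·n!·2εe^{2l₀}` ∀ n ≥ 1, `A′ = max(1, e·max(1,L)∕l₀)`) and ★★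
`law_controlled_of_cgf_close_symm` (∀ `0 < l₀` ∀ `η > 0` ∃ `ε₁ > 0`: laws on `[−1,1]` with cgf's `ε`-close, `ε ≤ ε₁`, are `η`-close on every `1`-Lipschitz `g`
with `|g| ≤ 1` on `[−1,1]`).  The lower half (`…N19LawPrice`: no modulus `≤ C∕log ε⁻¹`) transports the same way and is not re-typed.

HONEST FRAMING (binding).  Elementary and [folklore]; NO consumer in the DAG today beyond g9's continuum law (the by-name face at the scheme — laws of `prodObs`
under `Spine.NE7.Target` vs the continuum law — is the sibling `…N19LawPriceAtScheme`, to follow); nothing of Bałaban's is instantiated; NE7 ∕ NE7b ∕ NE7c NOT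
PRINTED, NOT proved; N19 NOT discharged; count-neutral.  One finite `T⁴` programme at fixed `ε`; nothing continuum ∕ `ℝ⁴` ∕ OS ∕ mass-gap ∕ Clay.  0 `def` ∕ 0 `sorry`.
-/

noncomputable section

open Real Finset MeasureTheory ProbabilityTheory

namespace Summit.QuantumFields.YangMills.Theorems.BalabanUVNodesN19LawPriceSymmetric

open Summit.QuantumFields.YangMills.Theorems.BalabanUVNodesN19LawPriceUpper (abs_integral_sub_integral_le_lipschitz_of_cgf_close)
open Summit.QuantumFields.YangMills.Theorems.BalabanUVNodesN19LawPriceModulus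
  (abs_integral_sub_integral_le_lipschitz_sqrt law_controlled_of_cgf_close)

/-! ## §1 Affine transport `x ↦ (x+1)∕2` of a law on `[−1,1]` to a law on `[0,1]` [folklore] -/

section Transport

variable {κ : Measure ℝ}

/-- The transported measure is a probability law. [folklore] -/
theorem isProbabilityMeasure_map_affine [IsProbabilityMeasure κ] : IsProbabilityMeasure (κ.map fun x : ℝ => (x + 1) / 2) :=
  Measure.isProbabilityMeasure_map (by fun_prop)

/-- A law on `[−1,1]` is transported to a law on `[0,1]`. [folklore] -/
theorem map_affine_Icc_compl (hκ : κ (Set.Icc (-1) 1)ᶜ = 0) : (κ.map fun x : ℝ => (x + 1) / 2) (Set.Icc 0 1)ᶜ = 0 := by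
  rw [Measure.map_apply (by fun_prop) (measurableSet_Icc.compl)]
  refine measure_mono_null (fun x hx => ?_) hκ
  simp only [Set.preimage_compl, Set.mem_compl_iff, Set.mem_preimage, Set.mem_Icc, not_and_or, not_le] at hx ⊢
  rcases hx with h | h
  · left; linarith
  · right; linarith

/-- Integrals transport: `∫ g d(κ∘φ⁻¹) = ∫ g((x+1)∕2) dκ` for continuous `g`. [folklore] -/
theorem integral_map_affine {g : ℝ → ℝ} (hg : Continuous g) :
    ∫ y, g y ∂(κ.map fun x : ℝ => (x + 1) / 2) = ∫ x, g ((x + 1) / 2) ∂κ :=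
  integral_map (by fun_prop) hg.aestronglyMeasurable

/-- A law on `[−1,1]` has `|x| ≤ 1` almost everywhere. [folklore] -/
theorem ae_abs_le_one_of_Icc_symm (hκ : κ (Set.Icc (-1) 1)ᶜ = 0) : ∀ᵐ x ∂κ, |id x| ≤ (1 : ℝ) := by
  have h : ∀ᵐ x ∂κ, x ∈ Set.Icc (-1 : ℝ) 1 := by
    rw [ae_iff]
    simpa only [Set.mem_Icc, Set.compl_def] using hκ
  exact h.mono fun x hx => by rw [id, abs_le]; exact ⟨hx.1, hx.2⟩

/-- The cgf transports: `cgf id (κ∘φ⁻¹) t = t∕2 + cgf id κ (t∕2)` (laws on `[−1,1]`: all exponential moments exist and are positive). [folklore] -/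
theorem cgf_map_affine [IsProbabilityMeasure κ] (hκ : κ (Set.Icc (-1) 1)ᶜ = 0) (t : ℝ) :
    cgf id (κ.map fun x : ℝ => (x + 1) / 2) t = t / 2 + cgf id κ (t / 2) := by
  have hmgf : mgf id (κ.map fun x : ℝ => (x + 1) / 2) t = Real.exp (t / 2) * mgf id κ (t / 2) := by
    rw [mgf_id_map (by fun_prop)]
    simp only [mgf, id, ← integral_const_mul]
    refine integral_congr_ae (ae_of_all _ fun x => ?_)
    show Real.exp (t * ((x + 1) / 2)) = Real.exp (t / 2) * Real.exp (t / 2 * x)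
    rw [← Real.exp_add]
    congr 1
    ring
  have hpos : 0 < mgf id κ (t / 2) :=
    Literature.MathematicalPhysics.QuantumFieldTheory.Balaban1983to89.T4GenFunBounds.mgf_pos_of_abs_le
      aemeasurable_id (ae_abs_le_one_of_Icc_symm hκ) (t / 2)
  simp only [cgf, hmgf]
  rw [Real.log_mul (Real.exp_pos _).ne' hpos.ne', Real.log_exp]

/-- Hence cgf DIFFERENCES transport with a halved source: `Δcgf'(t) = Δcgf(t∕2)`; `ε`-closeness on `|t| ≤ l₀` becomes `ε`-closeness on `|t| ≤ 2l₀`.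
[folklore] -/
theorem cgf_map_affine_close {μ ν : Measure ℝ} [IsProbabilityMeasure μ] [IsProbabilityMeasure ν]
    (hμ : μ (Set.Icc (-1) 1)ᶜ = 0) (hν : ν (Set.Icc (-1) 1)ᶜ = 0) {ε l₀ : ℝ}
    (hε : ∀ t : ℝ, |t| ≤ l₀ → |cgf id ν t - cgf id μ t| ≤ ε) (t : ℝ) (ht : |t| ≤ 2 * l₀) :
    |cgf id (ν.map fun x : ℝ => (x + 1) / 2) t - cgf id (μ.map fun x : ℝ => (x + 1) / 2) t| ≤ ε := by
  rw [cgf_map_affine hν, cgf_map_affine hμ, add_sub_add_left_eq_sub]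
  exact hε (t / 2) (by rw [abs_div, abs_two]; linarith)

end Transport

/-! ## §2 The law-level price for laws on `[−1, 1]` -/

section Symmetric

variable {μ ν : Measure ℝ} [IsProbabilityMeasure μ] [IsProbabilityMeasure ν]

/-- Pulling a test function back along `y ↦ 2y − 1` doubles its Lipschitz constant. [folklore] -/
theorem lipschitzWith_comp_affine {g : ℝ → ℝ} {K : NNReal} (hg : LipschitzWith K g) :
    LipschitzWith (2 * K) (fun y : ℝ => g (2 * y - 1)) := by
  refine LipschitzWith.of_dist_le_mul fun x y => ?_
  have h := hg.dist_le_mul (2 * x - 1) (2 * y - 1)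
  have e : dist (2 * x - 1) (2 * y - 1) = 2 * dist x y := by
    rw [Real.dist_eq, Real.dist_eq, show 2 * x - 1 - (2 * y - 1) = 2 * (x - y) by ring, abs_mul, abs_two]
  rw [e] at h
  push_cast
  linarith

/-- **★★ THE LAW-LEVEL PRICE FROM ABOVE FOR LAWS ON `[−1, 1]` (the range of N19's product observable; explicit, every degree `n`).**
Two probability laws `μ, ν` on `[−1,1]` with cgf's `ε`-close on `|t| ≤ l₀` (`0 < l₀`, `0 ≤ ε`), `g` `K`-Lipschitz with `|g| ≤ G` on `[−1,1]`: for every `n ≥ 1`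
`|∫ g dν − ∫ g dμ| ≤ 2K∕√n + G·(3A′)ⁿ·n!·2εe^{2l₀}`, `A′ = max(1, e·max(1, log⁺ε⁻¹)∕l₀)` — the sibling `…N19LawPriceUpper` for the transported laws on `[0,1]`
(§1: window `2l₀`, test function `y ↦ g(2y−1)` of constant `2K`). [folklore] -/
theorem abs_integral_sub_integral_le_lipschitz_of_cgf_close_symm (hμ : μ (Set.Icc (-1) 1)ᶜ = 0) (hν : ν (Set.Icc (-1) 1)ᶜ = 0)
    {ε l₀ : ℝ} (hl₀ : 0 < l₀) (hε0 : 0 ≤ ε) (hε : ∀ t : ℝ, |t| ≤ l₀ → |cgf id ν t - cgf id μ t| ≤ ε)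
    {g : ℝ → ℝ} {K : NNReal} (hg : LipschitzWith K g) {G : ℝ} (hG : ∀ x ∈ Set.Icc (-1 : ℝ) 1, |g x| ≤ G) {n : ℕ} (hn : 1 ≤ n) :
    |∫ x, g x ∂ν - ∫ x, g x ∂μ| ≤
      2 * K / Real.sqrt n + G * (3 * max 1 (2 * Real.exp 1 * max 1 (Real.posLog ε⁻¹) / (2 * l₀))) ^ n *
        (n.factorial * (2 * ε * Real.exp (2 * l₀))) := by
  haveI := isProbabilityMeasure_map_affine (κ := μ)
  haveI := isProbabilityMeasure_map_affine (κ := ν)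
  have hh : LipschitzWith (2 * K) (fun y : ℝ => g (2 * y - 1)) := lipschitzWith_comp_affine hg
  have hhG : ∀ y ∈ Set.Icc (0 : ℝ) 1, |g (2 * y - 1)| ≤ G := fun y hy =>
    hG (2 * y - 1) ⟨by linarith [hy.1], by linarith [hy.2]⟩
  have h := abs_integral_sub_integral_le_lipschitz_of_cgf_close (map_affine_Icc_compl hμ) (map_affine_Icc_compl hν)
    (by linarith : 0 < 2 * l₀) hε0 (cgf_map_affine_close hμ hν hε) hh hhG hn
  have hgc : Continuous fun y : ℝ => g (2 * y - 1) := hg.continuous.comp (by fun_prop)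
  rw [integral_map_affine hgc, integral_map_affine hgc] at h
  have e : ∀ x : ℝ, g (2 * ((x + 1) / 2) - 1) = g x := fun x => by congr 1; ring
  simp only [e, NNReal.coe_mul, NNReal.coe_ofNat] at h
  exact h

/-- **★★ WINDOW MATCHING CONTROLS THE LAW ON `[−1, 1]`, UNIFORMLY.**  ∀ `0 < l₀` ∀ `η > 0` ∃ `ε₁ > 0`: any two probability laws on `[−1,1]` whose cgf's are
`ε`-close on `|t| ≤ l₀` with `0 ≤ ε ≤ ε₁` satisfy `|∫ g dν − ∫ g dμ| ≤ η` for every `1`-Lipschitz `g` with `|g| ≤ 1` on `[−1,1]` — the sibling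
`…N19LawPriceModulus.law_controlled_of_cgf_close` at window `2l₀` and tolerance `η∕2`, applied to the `1`-Lipschitz `y ↦ g(2y−1)∕2`.  This is the form in
which N19's currency carries the continuum LAW of the product observable (p504707 ∕ p505344: laws on `[−1,1]`). [folklore] -/
theorem law_controlled_of_cgf_close_symm {l₀ : ℝ} (hl₀ : 0 < l₀) {η : ℝ} (hη : 0 < η) :
    ∃ ε₁ : ℝ, 0 < ε₁ ∧ ∀ (μ ν : Measure ℝ) [IsProbabilityMeasure μ] [IsProbabilityMeasure ν],
      μ (Set.Icc (-1) 1)ᶜ = 0 → ν (Set.Icc (-1) 1)ᶜ = 0 → ∀ ε : ℝ, 0 ≤ ε → ε ≤ ε₁ →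
        (∀ t : ℝ, |t| ≤ l₀ → |cgf id ν t - cgf id μ t| ≤ ε) →
        ∀ g : ℝ → ℝ, LipschitzWith 1 g → (∀ x ∈ Set.Icc (-1 : ℝ) 1, |g x| ≤ 1) →
          |∫ x, g x ∂ν - ∫ x, g x ∂μ| ≤ η := by
  obtain ⟨ε₁, hε₁, h⟩ := law_controlled_of_cgf_close (by linarith : 0 < 2 * l₀) (half_pos hη)
  refine ⟨ε₁, hε₁, fun μ ν _ _ hμ hν ε hε0 hε1 hε g hg hG => ?_⟩
  haveI := isProbabilityMeasure_map_affine (κ := μ)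
  haveI := isProbabilityMeasure_map_affine (κ := ν)
  -- the half-sized pulled-back test function is `1`-Lipschitz and bounded by `1`
  have hh : LipschitzWith 1 (fun y : ℝ => g (2 * y - 1) / 2) := by
    refine LipschitzWith.of_dist_le_mul fun x y => ?_
    have h2 := (lipschitzWith_comp_affine hg).dist_le_mul x y
    rw [Real.dist_eq] at h2 ⊢
    rw [← sub_div, abs_div, abs_two]
    push_cast at h2 ⊢
    linarith
  have hhG : ∀ y ∈ Set.Icc (0 : ℝ) 1, |g (2 * y - 1) / 2| ≤ 1 := fun y hy => by
    have h1 : |g (2 * y - 1)| ≤ 1 := hG (2 * y - 1) ⟨by linarith [hy.1], by linarith [hy.2]⟩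
    have e2 : |g (2 * y - 1) / 2| = |g (2 * y - 1)| / 2 := by rw [abs_div, abs_two]
    rw [e2]
    linarith
  have key := h _ _ (map_affine_Icc_compl hμ) (map_affine_Icc_compl hν) ε hε0 hε1 (cgf_map_affine_close hμ hν hε) _ hh hhG
  have hgc : Continuous fun y : ℝ => g (2 * y - 1) / 2 := (hg.continuous.comp (by fun_prop)).div_const _
  rw [integral_map_affine hgc, integral_map_affine hgc] at key
  have hint : ∀ κ : Measure ℝ, ∫ x, g (2 * ((x + 1) / 2) - 1) / 2 ∂κ = (1 / 2) * ∫ x, g x ∂κ := fun κ => by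
    rw [← integral_const_mul]
    refine integral_congr_ae (ae_of_all _ fun x => ?_)
    show g (2 * ((x + 1) / 2) - 1) / 2 = 1 / 2 * g x
    rw [show 2 * ((x + 1) / 2) - 1 = x by ring]
    ring
  rw [hint, hint, ← mul_sub, abs_mul, abs_of_pos (by norm_num : (0 : ℝ) < 1 / 2)] at key
  linarith

end Symmetric

end Summit.QuantumFields.YangMills.Theorems.BalabanUVNodesN19LawPriceSymmetric

end
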